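import Literature.Geometry.Kaehler.ComplexTorusHodgeGroupProductSl2Planes
import Literature.Geometry.Kaehler.ComplexTorusHodgeLieAlgebraComplexStableSubspaces
import HarnessLib

/-!
# `X₁ × X₂` when both complex Hodge Lie algebras act on `V_ℂ` through `𝔰𝔩₂`-planes, INTRINSIC FORM: the planes as `𝔤`-stable
# subspaces `U ⊆ V_ℂ` (traceless, jointly faithful, `dim 𝔤 = 3 · #planes`) ⟹ `Hg(X₁ × X₂)` splits or `Hom_ℚ ≠ 0`

Lane `lit-hodgefound`, seat p17, generation 52, self-proposed row g52-#6 — the bridge from the tree's language of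
`𝔤`-stable subspaces (`ComplexTorusHodgeLieAlgebraComplexStableSubspaces`: a `𝔤`-stable `U ⊆ V_ℂ` of a polarised torus is the
image of an idempotent of the commutant `End_ℚ(X) ⊗ ℂ`) to the matrix «plane data» consumed by g52-#5
(`hodgeGroupC_prod_eq_blockDiagProd_or_homRat_ne_bot_of_sl2Planes`).  THEOREMS ONLY (no definition, no instance, no notation, no
named fact; D-0026 net debt 0).

## The bridge (Moonen–Zarhin, proof of (3.3): «`V_X ⊗_ℚ ℂ ≅ U_1^d ⊕ ⋯ ⊕ U_e^d` as `𝔥𝔤(X)_ℂ`-modules […] acts on each of the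
## summands through `𝔰𝔩`»)

For a polarised complex torus `X` and a `𝔤 = Lie Hg(X)(ℂ)`-stable plane `U ⊆ V_ℂ`: the projector `π` onto `U` along a `𝔤`-stable
complement lies in `End_ℚ(X) ⊗ ℂ` and commutes with `𝔤` (`IsRiemannForm.exists_mem_span_endAlgRat_isIdempotentElem_range_eq`,
`mul_comm_of_mem_span_endAlgRat_of_mem_hodgeGroupLieC`); a basis of `U` factors `π = P Q` with `Q P = 1` (rank factorisation,
§0), and then `Z P = P (QZP)`, `Q Z = (QZP) Q` for `Z ∈ 𝔤`, with `QZP` the matrix of `Z|_U` — so the trace of `Z|_U`, the joint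
faithfulness and (by counting dimensions: `𝔤 ↪ ∏_U 𝔰𝔩(U)`, `dim 𝔤 = 3 · #U`) the joint surjectivity onto `∏ 𝔰𝔩₂` transfer.

## Sources, verbatim

* B. Moonen, Yu. G. Zarhin [MoonenZarhin1999LowDim], held `paper:arxiv-math_9901113`: §3 (3.1) (p0006 L25–L51), Thm. (3.2)(1)
  (p0006 L69–L74), proof of Lemma (3.3) (p0006 L94–L104: «There are irreducible `𝔥𝔤(X)_ℂ`-modules `U_1, …, U_e` […] `𝔥𝔤(X)_ℂ` acts on
  each of the summands `U_j^d` through `𝔰𝔩(U_j^d)`»; L126–L129), Lemma (3.4) (p0006 L133–L138).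
* B. B. Gordon [Gordon1997], §2 Lemma 2.6 («`End⁰(A) ≅ End_{Hg(A)}(H_1(A,ℚ))`»), §2.16 Proposition (Goursat).
* P. Deligne [Deligne1982HodgeCycles], I Prop. 3.6 (complete reducibility of `V` under `Hg`).

## What is proved

* §1 **`IsRiemannForm.exists_sl2PlaneData`**: from `𝔤`-stable planes `U_a ⊆ V_ℂ` (`a ∈ s`, `dim U_a = 2`) on which `𝔤` acts
  tracelessly and jointly faithfully, with `dim_ℂ 𝔤 = 3 · |s|`, the matrix plane data `P_a`, `Q_a` of g52-#5 (`Q P = 1`, stability,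
  trace `0`, jointly onto `∏ 𝔰𝔩₂`, jointly injective).
* §2 **`IsRiemannForm.hodgeGroupC_prod_eq_blockDiagProd_or_homRat_ne_bot_of_stablePlanes`**: two polarised tori with such planes ⟹
  `Hg(X₁ × X₂)(ℂ) = Hg(X₁)(ℂ) × Hg(X₂)(ℂ) ∨ Hom_ℚ(X₁, X₂) ≠ 0 ∨ Hom_ℚ(X₂, X₁) ≠ 0`; for SIMPLE non-isogenous factors the split
  (`IsSimple.homRat_eq_bot`).

## References

* [MoonenZarhin1999LowDim] B. Moonen, Yu. G. Zarhin, Math. Ann. 315 (1999), §3 (3.1), Thm. (3.2), Lemma (3.3)–(3.4) (arXiv v2 = Math. Ann. numbering: Lemma (3.3) = chunk p0006 L84–L131, Lemma (3.4) = p0006 L133–p0007 L7; earlier tree copies of this family wrote «(3.4)»∕«(3.5)»).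
* [Gordon1997] B. B. Gordon, *A survey of the Hodge conjecture for abelian varieties*, §2 Lemma 2.6, §2.16.
* [Deligne1982HodgeCycles] P. Deligne, *Hodge cycles on abelian varieties*, LNM 900 (1982), I Prop. 3.6.
-/

noncomputable section

open Matrix Module

namespace Literature.Geometry.Kaehler

namespace ComplexTorus

open Literature.NumberTheory.Automorphic (lieAlgebraGL lie_mem_lieAlgebraGL)

/-! ### §0 Rank factorisation of an idempotent through a basis of its range (file-local) -/

section RankFactorisation

variable {K : Type*} [Field K] {ι : Type*} [Fintype ι] [DecidableEq ι] {n : ℕ}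

/-- An idempotent matrix `π` with range `U` and a basis `b` of `U` give `P ∈ M_{ι×n}`, `Q ∈ M_{n×ι}` with `Q P = 1`, `P Q = π`, and
`Q Z P =` the matrix of `Z|_U` in `b` for every `Z` preserving `U`. [folklore] -/
private theorem exists_mul_eq_one_and_mul_eq_and_forall_eq_toMatrix_restrict₁₃₄ {U : Submodule K (ι → K)} {π : Matrix ι ι K}
    (hπ : IsIdempotentElem π) (hU : LinearMap.range (Matrix.toLin' π) = U) (b : Basis (Fin n) K U) :
    ∃ (P : Matrix ι (Fin n) K) (Q : Matrix (Fin n) ι K), Q * P = 1 ∧ P * Q = π ∧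
      ∀ (Z : Matrix ι ι K) (hZ : ∀ u ∈ U, Matrix.toLin' Z u ∈ U),
        Q * Z * P = LinearMap.toMatrix b b ((Matrix.toLin' Z).restrict hZ) := by
  have hπU : ∀ v, Matrix.toLin' π v ∈ U := fun v ↦ hU ▸ LinearMap.mem_range_self _ v
  have hπid : ∀ u ∈ U, Matrix.toLin' π u = u := by
    intro u hu
    rw [← hU] at hu
    obtain ⟨v, rfl⟩ := hu
    rw [Matrix.toLin'_apply, Matrix.toLin'_apply, Matrix.mulVec_mulVec, hπ.eq]
  set Lp : (Fin n → K) →ₗ[K] (ι → K) := U.subtype ∘ₗ (b.equivFun.symm : (Fin n → K) →ₗ[K] U) with hLp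
  set Lq : (ι → K) →ₗ[K] (Fin n → K) := (b.equivFun : U →ₗ[K] (Fin n → K)) ∘ₗ LinearMap.codRestrict U (Matrix.toLin' π) hπU
    with hLq
  have hqp : Lq ∘ₗ Lp = LinearMap.id := by
    apply LinearMap.ext
    intro c
    have h1 : LinearMap.codRestrict U (Matrix.toLin' π) hπU ((b.equivFun.symm c : U) : ι → K) = b.equivFun.symm c :=
      Subtype.ext (hπid _ (b.equivFun.symm c).2)
    simp only [hLq, hLp, LinearMap.comp_apply, LinearEquiv.coe_coe, Submodule.subtype_apply, LinearMap.id_apply, h1,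
      LinearEquiv.apply_symm_apply]
  have hpq : Lp ∘ₗ Lq = Matrix.toLin' π := by
    apply LinearMap.ext
    intro v
    simp only [hLq, hLp, LinearMap.comp_apply, LinearEquiv.coe_coe, Submodule.subtype_apply, LinearEquiv.symm_apply_apply,
      LinearMap.codRestrict_apply]
  refine ⟨LinearMap.toMatrix' Lp, LinearMap.toMatrix' Lq, ?_, ?_, fun Z hZ ↦ ?_⟩
  · rw [← LinearMap.toMatrix'_comp, hqp, LinearMap.toMatrix'_id]
  · rw [← LinearMap.toMatrix'_comp, hpq, LinearMap.toMatrix'_toLin']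
  · have hc : Lq ∘ₗ (Matrix.toLin' Z ∘ₗ Lp) = LinearEquiv.arrowCongr b.equivFun b.equivFun ((Matrix.toLin' Z).restrict hZ) := by
      apply LinearMap.ext
      intro c
      have h1 : LinearMap.codRestrict U (Matrix.toLin' π) hπU (Matrix.toLin' Z ((b.equivFun.symm c : U) : ι → K)) =
          (Matrix.toLin' Z).restrict hZ (b.equivFun.symm c) :=
        Subtype.ext (by rw [LinearMap.codRestrict_apply, LinearMap.coe_restrict_apply]; exact hπid _ (hZ _ (b.equivFun.symm c).2))
      simp only [hLq, hLp, LinearMap.comp_apply, LinearEquiv.coe_coe, Submodule.subtype_apply, LinearEquiv.arrowCongr_apply, h1]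
    calc LinearMap.toMatrix' Lq * Z * LinearMap.toMatrix' Lp
        = LinearMap.toMatrix' Lq * LinearMap.toMatrix' (Matrix.toLin' Z) * LinearMap.toMatrix' Lp := by
          rw [LinearMap.toMatrix'_toLin']
      _ = LinearMap.toMatrix' (Lq ∘ₗ (Matrix.toLin' Z ∘ₗ Lp)) := by
          rw [LinearMap.toMatrix'_comp, LinearMap.toMatrix'_comp, Matrix.mul_assoc]
      _ = LinearMap.toMatrix b b ((Matrix.toLin' Z).restrict hZ) := by rw [hc]; rfl

end RankFactorisation

/-! ## §1 From `𝔤`-stable planes to matrix plane data -/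

section OneTorus

variable {ι : Type*} [Fintype ι] [DecidableEq ι] {E : Type*} [NormedAddCommGroup E] [NormedSpace ℂ E]
  {Φ : (ι → ℝ) ≃L[ℝ] E} {η : E [⋀^Fin 2]→L[ℝ] ℝ}

/-- **PLANE DATA FROM `𝔤`-STABLE PLANES** (polarised complex torus `X`, `𝔤 = Lie Hg(X)(ℂ)`).  Let `U_a ⊆ V_ℂ` (`a ∈ s`, finite) be
`𝔤`-stable planes on which `𝔤` acts tracelessly and jointly faithfully, with `dim_ℂ 𝔤 = 3 · |s|`.  Then there are
`P_a ∈ M_{ι×2}(ℂ)`, `Q_a ∈ M_{2×ι}(ℂ)` with `Q_a P_a = 1`, `Z P_a = P_a (Q_a Z P_a)` and `Q_a Z = (Q_a Z P_a) Q_a` for `Z ∈ 𝔤` (the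
projector `P_a Q_a` onto `U_a` lies in `End_ℚ(X) ⊗ ℂ` and commutes with `𝔤`), `tr(Q_a Z P_a) = 0`, `Z ↦ (Q_a Z P_a)_a` ONTO the
trace-free families and INJECTIVE («`V_X ⊗ ℂ ≅ ⊕ U_j`, `𝔥𝔤(X)_ℂ` acts on each summand through `𝔰𝔩(U_j)`», here `𝔤 ≅ ∏_a 𝔰𝔩(U_a)`).
[cite: MoonenZarhin1999LowDim, §3 proof of Lemma (3.3) (p0006 L94–L104)] [cite: Gordon1997, §2 Lemma 2.6] [cite: Deligne1982HodgeCycles, I Prop. 3.6] -/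
theorem IsRiemannForm.exists_sl2PlaneData {s : Type*} [Fintype s] (hη : IsRiemannForm Φ η) (U : s → Submodule ℂ (ι → ℂ))
    (hU : ∀ a, ∀ Z ∈ lieAlgebraGL ((hodgeGroupC Φ).map Matrix.SpecialLinearGroup.toGL), ∀ u ∈ U a, Matrix.toLin' Z u ∈ U a)
    (h2 : ∀ a, finrank ℂ (U a) = 2)
    (htr : ∀ a Z (hZ : Z ∈ lieAlgebraGL ((hodgeGroupC Φ).map Matrix.SpecialLinearGroup.toGL)),
      LinearMap.trace ℂ _ ((Matrix.toLin' Z).restrict (hU a Z hZ)) = 0)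
    (hinj : ∀ Z ∈ lieAlgebraGL ((hodgeGroupC Φ).map Matrix.SpecialLinearGroup.toGL),
      (∀ a, ∀ u ∈ U a, Matrix.toLin' Z u = 0) → Z = 0)
    (hdim : finrank ℂ (lieAlgebraGL ((hodgeGroupC Φ).map Matrix.SpecialLinearGroup.toGL)) = 3 * Fintype.card s) :
    ∃ (P : s → Matrix ι (Fin 2) ℂ) (Q : s → Matrix (Fin 2) ι ℂ), (∀ a, Q a * P a = 1) ∧
      (∀ a, ∀ Z ∈ lieAlgebraGL ((hodgeGroupC Φ).map Matrix.SpecialLinearGroup.toGL),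
        Z * P a = P a * (Q a * Z * P a) ∧ Q a * Z = Q a * Z * P a * Q a) ∧
      (∀ a, ∀ Z ∈ lieAlgebraGL ((hodgeGroupC Φ).map Matrix.SpecialLinearGroup.toGL), (Q a * Z * P a).trace = 0) ∧
      (∀ X : s → Matrix (Fin 2) (Fin 2) ℂ, (∀ a, (X a).trace = 0) →
        ∃ Z ∈ lieAlgebraGL ((hodgeGroupC Φ).map Matrix.SpecialLinearGroup.toGL), ∀ a, Q a * Z * P a = X a) ∧
      (∀ Z ∈ lieAlgebraGL ((hodgeGroupC Φ).map Matrix.SpecialLinearGroup.toGL), (∀ a, Q a * Z * P a = 0) → Z = 0) := by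
  classical
  set G := lieAlgebraGL ((hodgeGroupC Φ).map Matrix.SpecialLinearGroup.toGL) with hGdef
  have hUC : ∀ a, ∀ Z ∈ hodgeGroupLieC Φ, ∀ u ∈ U a, Z *ᵥ u ∈ U a := fun a Z hZ u hu ↦ by
    rw [← Matrix.toLin'_apply]
    exact hU a Z ((mem_hodgeGroupLieC_iff_mem_lieAlgebraGL Φ).1 hZ) u hu
  -- per plane: the commutant projector, factored through a basis
  have hex : ∀ a, ∃ (P : Matrix ι (Fin 2) ℂ) (Q : Matrix (Fin 2) ι ℂ), Q * P = 1 ∧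
      (∀ Z ∈ G, Z * P = P * (Q * Z * P) ∧ Q * Z = Q * Z * P * Q) ∧
      ∀ (Z : Matrix ι ι ℂ) (hZ : ∀ u ∈ U a, Matrix.toLin' Z u ∈ U a),
        Q * Z * P = LinearMap.toMatrix (finBasisOfFinrankEq ℂ (U a) (h2 a)) (finBasisOfFinrankEq ℂ (U a) (h2 a))
          ((Matrix.toLin' Z).restrict hZ) := by
    intro a
    obtain ⟨π, hπspan, hπid, hπU⟩ := hη.exists_mem_span_endAlgRat_isIdempotentElem_range_eq (hUC a)
    obtain ⟨P, Q, hQP, hPQ, hmat⟩ :=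
      exists_mul_eq_one_and_mul_eq_and_forall_eq_toMatrix_restrict₁₃₄ hπid hπU (finBasisOfFinrankEq ℂ (U a) (h2 a))
    refine ⟨P, Q, hQP, fun Z hZ ↦ ?_, hmat⟩
    have hc : π * Z = Z * π :=
      mul_comm_of_mem_span_endAlgRat_of_mem_hodgeGroupLieC hπspan ((mem_hodgeGroupLieC_iff_mem_lieAlgebraGL Φ).2 hZ)
    constructor
    · calc Z * P = Z * (P * (Q * P)) := by rw [hQP, Matrix.mul_one]
        _ = Z * π * P := by rw [← Matrix.mul_assoc P, hPQ, Matrix.mul_assoc]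
        _ = π * Z * P := by rw [hc]
        _ = P * (Q * Z * P) := by rw [← hPQ]; simp only [Matrix.mul_assoc]
    · calc Q * Z = Q * P * Q * Z := by rw [hQP, Matrix.one_mul]
        _ = Q * π * Z := by rw [Matrix.mul_assoc Q P, hPQ]
        _ = Q * (Z * π) := by rw [Matrix.mul_assoc, hc]
        _ = Q * Z * P * Q := by rw [← hPQ]; simp only [Matrix.mul_assoc]
  choose P Q hQP hst hmat using hex
  -- trace and faithfulness transfer
  have htr' : ∀ a, ∀ Z ∈ G, (Q a * Z * P a).trace = 0 := fun a Z hZ ↦ by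
    rw [hmat a Z (hU a Z hZ), ← LinearMap.trace_eq_matrix_trace]
    exact htr a Z hZ
  have hinj' : ∀ Z ∈ G, (∀ a, Q a * Z * P a = 0) → Z = 0 := by
    intro Z hZ h0
    refine hinj Z hZ fun a u hu ↦ ?_
    have h := hmat a Z (hU a Z hZ)
    rw [h0 a] at h
    have hr : (Matrix.toLin' Z).restrict (hU a Z hZ) = 0 := (LinearEquiv.map_eq_zero_iff _).1 h.symm
    have hu' := LinearMap.congr_fun hr ⟨u, hu⟩
    rw [LinearMap.restrict_apply, LinearMap.zero_apply, Submodule.mk_eq_zero] at hu'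
    exact hu'
  refine ⟨P, Q, hQP, hst, htr', fun X hX ↦ ?_, hinj'⟩
  -- joint surjectivity by counting dimensions: `𝔤 ↪ ∏_a 𝔰𝔩₂`, both of dimension `3|s|`
  let Ψ : G →ₗ[ℂ] (s → Matrix (Fin 2) (Fin 2) ℂ) :=
    { toFun := fun Z a ↦ Q a * (Z : Matrix ι ι ℂ) * P a
      map_add' := fun Z W ↦ by
        funext a
        change Q a * ((Z : Matrix ι ι ℂ) + (W : Matrix ι ι ℂ)) * P a = Q a * (Z : Matrix ι ι ℂ) * P a + Q a * (W : Matrix ι ι ℂ) * P a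
        rw [Matrix.mul_add, Matrix.add_mul]
      map_smul' := fun c Z ↦ by
        funext a
        change Q a * (c • (Z : Matrix ι ι ℂ)) * P a = c • (Q a * (Z : Matrix ι ι ℂ) * P a)
        rw [Matrix.mul_smul, Matrix.smul_mul] }
  have hΨ : ∀ (Z : G) a, Ψ Z a = Q a * (Z : Matrix ι ι ℂ) * P a := fun Z a ↦ rfl
  let L : (s → Matrix (Fin 2) (Fin 2) ℂ) →ₗ[ℂ] (s → ℂ) :=
    { toFun := fun Y a ↦ (Y a).trace
      map_add' := fun Y Y' ↦ by
        funext a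
        exact Matrix.trace_add _ _
      map_smul' := fun c Y ↦ by
        funext a
        change (c • Y a).trace = c • (Y a).trace
        exact Matrix.trace_smul _ _ }
  have hL : ∀ Y a, L Y a = (Y a).trace := fun Y a ↦ rfl
  have hΨinj : Function.Injective Ψ := by
    rw [injective_iff_map_eq_zero]
    intro Z hZ0
    exact Subtype.ext (hinj' Z Z.2 fun a ↦ by rw [← hΨ, hZ0]; rfl)
  have hle : LinearMap.range Ψ ≤ LinearMap.ker L := by
    rintro Y ⟨Z, rfl⟩
    rw [LinearMap.mem_ker]
    funext a
    rw [hL, hΨ]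
    exact htr' a Z Z.2
  have hLsurj : Function.Surjective L := fun c ↦ ⟨fun a ↦ !![c a, 0; 0, 0], funext fun a ↦ by
    rw [hL]; simp [Matrix.trace_fin_two]⟩
  have hker : finrank ℂ (LinearMap.ker L) = 3 * Fintype.card s := by
    have h1 := LinearMap.finrank_range_add_finrank_ker L
    rw [LinearMap.range_eq_top.2 hLsurj, finrank_top, Module.finrank_pi ℂ, Module.finrank_pi_fintype] at h1
    simp only [Module.finrank_matrix, Fintype.card_fin, Module.finrank_self, mul_one, Finset.sum_const, Finset.card_univ,
      smul_eq_mul] at h1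
    omega
  have hrange : LinearMap.range Ψ = LinearMap.ker L :=
    Submodule.eq_of_le_of_finrank_eq hle (by rw [LinearMap.finrank_range_of_inj hΨinj, hker, hGdef, hdim])
  have hXker : X ∈ LinearMap.ker L := by
    rw [LinearMap.mem_ker]
    funext a
    rw [hL]
    exact hX a
  rw [← hrange] at hXker
  obtain ⟨Z, hZ⟩ := hXker
  exact ⟨Z, Z.2, fun a ↦ by rw [← hΨ, hZ]⟩

end OneTorus

/-! ## §2 Two polarised tori with `𝔰𝔩₂`-planes: the Hodge group splits or `Hom_ℚ ≠ 0` -/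

variable {ι₁ ι₂ : Type*} [Fintype ι₁] [DecidableEq ι₁] [Fintype ι₂] [DecidableEq ι₂]
  {E₁ E₂ : Type*} [NormedAddCommGroup E₁] [NormedSpace ℂ E₁] [NormedAddCommGroup E₂] [NormedSpace ℂ E₂]
  {Φ₁ : (ι₁ → ℝ) ≃L[ℝ] E₁} {Φ₂ : (ι₂ → ℝ) ≃L[ℝ] E₂} {η₁ : E₁ [⋀^Fin 2]→L[ℝ] ℝ} {η₂ : E₂ [⋀^Fin 2]→L[ℝ] ℝ}

/-- **MOONEN–ZARHIN (3.1)∕(3.4) FOR `𝔰𝔩₂`-ISOTYPIC FACTORS, INTRINSIC FORM.**  Let `X₁`, `X₂` be polarised complex tori; for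
`k = 1, 2` let `U_{k,a} ⊆ V_{k,ℂ}` (`a ∈ sₖ`, finite) be `𝔤ₖ = Lie Hg(Xₖ)(ℂ)`-stable planes on which `𝔤ₖ` acts tracelessly and
jointly faithfully, with `dim_ℂ 𝔤ₖ = 3 · |sₖ|` (so `𝔤ₖ ≅ ∏_a 𝔰𝔩(U_{k,a})`: «`𝔥𝔤(X)_ℂ` acts on each of the summands through `𝔰𝔩`»).
Then `Hg(X₁ × X₂)(ℂ) = Hg(X₁)(ℂ) × Hg(X₂)(ℂ)`, or `Hom_ℚ(X₁, X₂) ≠ 0`, or `Hom_ℚ(X₂, X₁) ≠ 0`.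
[cite: MoonenZarhin1999LowDim, §3 (3.1), Thm. (3.2)(1) (p0006 L69–L74), proof of Lemma (3.3) (p0006 L94–L104, L126–L129), Lemma (3.4)]
[cite: Gordon1997, §2 Lemma 2.6 and §2.16 Proposition] -/
theorem IsRiemannForm.hodgeGroupC_prod_eq_blockDiagProd_or_homRat_ne_bot_of_stablePlanes {s₁ s₂ : Type*} [Fintype s₁]
    [Fintype s₂] [DecidableEq s₁] [DecidableEq s₂] (hη₁ : IsRiemannForm Φ₁ η₁) (hη₂ : IsRiemannForm Φ₂ η₂)
    (U₁ : s₁ → Submodule ℂ (ι₁ → ℂ)) (U₂ : s₂ → Submodule ℂ (ι₂ → ℂ))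
    (hU₁ : ∀ a, ∀ Z ∈ lieAlgebraGL ((hodgeGroupC Φ₁).map Matrix.SpecialLinearGroup.toGL), ∀ u ∈ U₁ a, Matrix.toLin' Z u ∈ U₁ a)
    (hU₂ : ∀ b, ∀ Z ∈ lieAlgebraGL ((hodgeGroupC Φ₂).map Matrix.SpecialLinearGroup.toGL), ∀ u ∈ U₂ b, Matrix.toLin' Z u ∈ U₂ b)
    (h2₁ : ∀ a, finrank ℂ (U₁ a) = 2) (h2₂ : ∀ b, finrank ℂ (U₂ b) = 2)
    (htr₁ : ∀ a Z (hZ : Z ∈ lieAlgebraGL ((hodgeGroupC Φ₁).map Matrix.SpecialLinearGroup.toGL)),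
      LinearMap.trace ℂ _ ((Matrix.toLin' Z).restrict (hU₁ a Z hZ)) = 0)
    (htr₂ : ∀ b Z (hZ : Z ∈ lieAlgebraGL ((hodgeGroupC Φ₂).map Matrix.SpecialLinearGroup.toGL)),
      LinearMap.trace ℂ _ ((Matrix.toLin' Z).restrict (hU₂ b Z hZ)) = 0)
    (hinj₁ : ∀ Z ∈ lieAlgebraGL ((hodgeGroupC Φ₁).map Matrix.SpecialLinearGroup.toGL),
      (∀ a, ∀ u ∈ U₁ a, Matrix.toLin' Z u = 0) → Z = 0)
    (hinj₂ : ∀ Z ∈ lieAlgebraGL ((hodgeGroupC Φ₂).map Matrix.SpecialLinearGroup.toGL),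
      (∀ b, ∀ u ∈ U₂ b, Matrix.toLin' Z u = 0) → Z = 0)
    (hdim₁ : finrank ℂ (lieAlgebraGL ((hodgeGroupC Φ₁).map Matrix.SpecialLinearGroup.toGL)) = 3 * Fintype.card s₁)
    (hdim₂ : finrank ℂ (lieAlgebraGL ((hodgeGroupC Φ₂).map Matrix.SpecialLinearGroup.toGL)) = 3 * Fintype.card s₂) :
    hodgeGroupC (prodPeriod Φ₁ Φ₂) = blockDiagProd (hodgeGroupC Φ₁) (hodgeGroupC Φ₂) ∨ homRat Φ₁ Φ₂ ≠ ⊥ ∨ homRat Φ₂ Φ₁ ≠ ⊥ := by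
  obtain ⟨P₁, Q₁, hQP₁, hst₁, htr₁', hsurj₁, hinj₁'⟩ := hη₁.exists_sl2PlaneData U₁ hU₁ h2₁ htr₁ hinj₁ hdim₁
  obtain ⟨P₂, Q₂, hQP₂, hst₂, htr₂', hsurj₂, hinj₂'⟩ := hη₂.exists_sl2PlaneData U₂ hU₂ h2₂ htr₂ hinj₂ hdim₂
  exact hodgeGroupC_prod_eq_blockDiagProd_or_homRat_ne_bot_of_sl2Planes P₁ Q₁ P₂ Q₂ hQP₁ hQP₂ hst₁ hst₂ htr₁' htr₂' hsurj₁ hsurj₂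
    hinj₁' hinj₂'

/-- **Simple, non-isogenous factors with `𝔰𝔩₂`-planes ⟹ `Hg(X₁ × X₂)(ℂ) = Hg(X₁)(ℂ) × Hg(X₂)(ℂ)`** (`Hom_ℚ` between simple
non-isogenous tori vanishes: `IsSimple.homRat_eq_bot`) — Hazama's Thm. (3.2)(1) for factors whose Hodge Lie algebras are read on
`𝔰𝔩₂`-planes (types I(2), II(1) of simple abelian surfaces). [cite: MoonenZarhin1999LowDim, §3 Thm. (3.2)(1) (p0006 L69–L74) and proof of (3.3), Lemma (3.4)] -/
theorem IsSimple.hodgeGroupC_prod_eq_blockDiagProd_of_stablePlanes_of_not_isIsogenous {s₁ s₂ : Type*} [Fintype s₁]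
    [Fintype s₂] [DecidableEq s₁] [DecidableEq s₂] (hX₁ : IsSimple Φ₁) (hX₂ : IsSimple Φ₂) (hη₁ : IsRiemannForm Φ₁ η₁)
    (hη₂ : IsRiemannForm Φ₂ η₂) (hne : ¬ IsIsogenous Φ₂ Φ₁)
    (U₁ : s₁ → Submodule ℂ (ι₁ → ℂ)) (U₂ : s₂ → Submodule ℂ (ι₂ → ℂ))
    (hU₁ : ∀ a, ∀ Z ∈ lieAlgebraGL ((hodgeGroupC Φ₁).map Matrix.SpecialLinearGroup.toGL), ∀ u ∈ U₁ a, Matrix.toLin' Z u ∈ U₁ a)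
    (hU₂ : ∀ b, ∀ Z ∈ lieAlgebraGL ((hodgeGroupC Φ₂).map Matrix.SpecialLinearGroup.toGL), ∀ u ∈ U₂ b, Matrix.toLin' Z u ∈ U₂ b)
    (h2₁ : ∀ a, finrank ℂ (U₁ a) = 2) (h2₂ : ∀ b, finrank ℂ (U₂ b) = 2)
    (htr₁ : ∀ a Z (hZ : Z ∈ lieAlgebraGL ((hodgeGroupC Φ₁).map Matrix.SpecialLinearGroup.toGL)),
      LinearMap.trace ℂ _ ((Matrix.toLin' Z).restrict (hU₁ a Z hZ)) = 0)
    (htr₂ : ∀ b Z (hZ : Z ∈ lieAlgebraGL ((hodgeGroupC Φ₂).map Matrix.SpecialLinearGroup.toGL)),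
      LinearMap.trace ℂ _ ((Matrix.toLin' Z).restrict (hU₂ b Z hZ)) = 0)
    (hinj₁ : ∀ Z ∈ lieAlgebraGL ((hodgeGroupC Φ₁).map Matrix.SpecialLinearGroup.toGL),
      (∀ a, ∀ u ∈ U₁ a, Matrix.toLin' Z u = 0) → Z = 0)
    (hinj₂ : ∀ Z ∈ lieAlgebraGL ((hodgeGroupC Φ₂).map Matrix.SpecialLinearGroup.toGL),
      (∀ b, ∀ u ∈ U₂ b, Matrix.toLin' Z u = 0) → Z = 0)
    (hdim₁ : finrank ℂ (lieAlgebraGL ((hodgeGroupC Φ₁).map Matrix.SpecialLinearGroup.toGL)) = 3 * Fintype.card s₁)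
    (hdim₂ : finrank ℂ (lieAlgebraGL ((hodgeGroupC Φ₂).map Matrix.SpecialLinearGroup.toGL)) = 3 * Fintype.card s₂) :
    hodgeGroupC (prodPeriod Φ₁ Φ₂) = blockDiagProd (hodgeGroupC Φ₁) (hodgeGroupC Φ₂) := by
  rcases hη₁.hodgeGroupC_prod_eq_blockDiagProd_or_homRat_ne_bot_of_stablePlanes hη₂ U₁ U₂ hU₁ hU₂ h2₁ h2₂ htr₁ htr₂ hinj₁ hinj₂
    hdim₁ hdim₂ with h | h | h
  · exact h
  · exact (h (hX₁.homRat_eq_bot hX₂ fun h' ↦ hne h'.symm)).elim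
  · exact (h (hX₂.homRat_eq_bot hX₁ hne)).elim

end ComplexTorus

end Literature.Geometry.Kaehler
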